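import Literature.InformationTheory.QuantumCodes.AbelianTwoBlockPaddedLogicals
import HarnessLib

/-!
# Abelian two-block codes: an order-2 pair `δ₀ + δ_t` in `ker A ∩ ker B` forces `d ≤ 2`
# (the kernel-weight bound `d ≤ |e|` HOLDS for kernel elements that are cosets of an order-2 subgroup)

Setting: a finite abelian group `G`, `a, b ∈ 𝔽₂[G]`, the abelian two-block CSS code `css a b`
(`H_X = [A|B]`, `H_Z = [Bᵀ|Aᵀ]`, `A = circulant a`, `B = circulant b`; Lin–Pryadko 2024 §IV, Bravyi et al. 2024 §4),
`K = ker A ∩ ker B`.  The data-conjecture X-2 of the qec cell («`d_Z ≤ |e|` for every non-zero `e ∈ K`») is a theorem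
for cyclic `G` (Wang–Pryadko 2022 St. 2) and for `|G|` odd (`AbelianTwoBlock.css_dZ_le_hammingNorm_of_card_odd`), and is
FALSE in general at even order (`Census/BB/TwoBlockKernelWeightCounterexample.lean`: a `[[48,12,6]]` code on `ℤ₂ × ℤ₁₂` whose
`K` contains the indicator of a subgroup `≅ ℤ₂ × ℤ₂`).  This file proves the complementary POSITIVE statement for the
smallest even case:

* `css_dZ_le_two_of_pair_mem_ker` — **if `t ∈ G` has order 2 and `e = δ₀ + δ_t` (the indicator of the subgroup
  `{0, t}`) satisfies `A e = B e = 0`, then `d_Z(css a b) ≤ 2 = |e|`**; likewise `d_X` (`css_dX_le_two_of_pair_mem_ker`).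
  So the bound `d ≤ |e|` holds for every kernel element that is (a translate of) the indicator of an ORDER-2 subgroup —
  in contrast with order-4 subgroups `≅ ℤ₂ × ℤ₂`, where it fails.

Mechanism (ours; elementary group-algebra manipulation, all in terms of the convolution `u ⋆ v = circulant u *ᵥ v`
of `AbelianTwoBlockPaddedLogicals.lean`): `A e = 0` says `a` is `t`-periodic; with `2t = 0` one has `e ⋆ e = 0` and the
HALVING LEMMA `exists_conv_pairInd_eq` (a periodic `x` is `e ⋆ x₀` for the restriction `x₀` of `x` to a transversal of
`{0,t}` — the transversal is cut out by comparing `g` and `g + t` in an enumeration of `G`).  If `(e, 0)` were a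
`Z`-stabilizer, `e = b ⋆ s` and `a ⋆ s = 0` for some `s` (`sumElim_mem_range_vecMulLinear_HZ_iff`); writing `b = e ⋆ b₀` and
`u = b₀ ⋆ s` gives `e ⋆ u = e`, so `c = u + δ₀` is periodic, `c = e ⋆ c₀`, `c ⋆ c = 0`; but `a ⋆ u = b₀ ⋆ (a ⋆ s) = 0` gives
`a ⋆ c = a`, whence `a = a ⋆ c ⋆ c = 0` — so for `a ≠ 0` the weight-2 vector `(e, 0)` is a non-trivial `Z`-logical
(`sumElim_pairInd_not_mem_rowSpace`); symmetrically `(0, e)` when `b ≠ 0`; and for `a = b = 0` every vector is a logical.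

HONEST FRAMING: a small structural lemma of ours about abelian two-block codes (no printed statement is formalized or
contradicted here); it explains why the counterexamples to X-2 found by the cell need a non-cyclic 2-subgroup.  All proved,
axioms standard, no `decide` on data, 0 kit.
-/

namespace Summit.Ventures.QEC.TwoBlockOrderTwo

open Matrix Literature.InformationTheory.QuantumCodes Literature.InformationTheory.QuantumCodes.AbelianTwoBlock

variable {G : Type*} [AddCommGroup G] [Fintype G] [DecidableEq G]

/-! ## The pair indicator `e = δ₀ + δ_t` and its convolutions -/

/-- The indicator `δ₀ + δ_t : G → 𝔽₂` of the pair `{0, t}` (the subgroup generated by an element `t` of order 2).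
(definition) -/
def pairInd (t : G) : G → ZMod 2 := Pi.single 0 1 + Pi.single t 1

omit [AddCommGroup G] [Fintype G] [DecidableEq G] in
/-- In `𝔽₂`-valued functions, `u + u = 0`. -/
theorem add_self_fun (u : G → ZMod 2) : u + u = 0 := by
  funext g; exact CharTwo.add_self_eq_zero (u g)

/-- `(x ⋆ δ_h)(g) = x (g - h)`: convolution with a point mass is a translate. -/
theorem conv_single_apply (x : G → ZMod 2) (h g : G) : (circulant x *ᵥ Pi.single h 1) g = x (g - h) := by
  simp [Matrix.mulVec, dotProduct, circulant_apply, Pi.single_apply]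

/-- `x ⋆ δ₀ = x`. -/
theorem conv_single_zero (x : G → ZMod 2) : circulant x *ᵥ Pi.single 0 1 = x := by
  funext g; rw [conv_single_apply, sub_zero]

/-- `(x ⋆ e)(g) = x g + x (g - t)` for `e = δ₀ + δ_t`. -/
theorem conv_pairInd_apply (x : G → ZMod 2) (t g : G) :
    (circulant x *ᵥ pairInd t) g = x g + x (g - t) := by
  rw [pairInd, Matrix.mulVec_add, Pi.add_apply, conv_single_apply, conv_single_apply, sub_zero]

/-- `x ⋆ e = 0` iff `x` is `t`-periodic: `x g = x (g - t)` for all `g`. -/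
theorem conv_pairInd_eq_zero_iff (x : G → ZMod 2) (t : G) :
    circulant x *ᵥ pairInd t = 0 ↔ ∀ g, x g = x (g - t) := by
  constructor
  · intro h g
    have hg := congr_fun h g
    rw [conv_pairInd_apply, Pi.zero_apply] at hg
    calc x g = x g + (x (g - t) + x (g - t)) := by rw [CharTwo.add_self_eq_zero, add_zero]
      _ = (x g + x (g - t)) + x (g - t) := by rw [add_assoc]
      _ = x (g - t) := by rw [hg, zero_add]
  · intro h
    funext g
    rw [conv_pairInd_apply, Pi.zero_apply, ← h g, CharTwo.add_self_eq_zero]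

/-- In characteristic two with `t + t = 0`: `e ⋆ e = 0` for `e = δ₀ + δ_t`. -/
theorem pairInd_conv_pairInd {t : G} (h2 : t + t = 0) :
    circulant (pairInd t) *ᵥ pairInd t = (0 : G → ZMod 2) := by
  rw [conv_pairInd_eq_zero_iff]
  have h3 : ∀ g : G, (g - t = t) ↔ (g = 0) := fun g => by rw [sub_eq_iff_eq_add, h2]
  intro g
  simp only [pairInd, Pi.add_apply, Pi.single_apply, sub_eq_zero, h3]
  exact add_comm _ _

/-- `(e ⋆ x) ⋆ (e ⋆ x) = 0` (since `e ⋆ e = 0` and `⋆` is commutative and associative). -/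
theorem conv_self_of_pairInd_conv {t : G} (h2 : t + t = 0) (x : G → ZMod 2) :
    circulant (circulant (pairInd t) *ᵥ x) *ᵥ (circulant (pairInd t) *ᵥ x) = 0 := by
  calc circulant (circulant (pairInd t) *ᵥ x) *ᵥ (circulant (pairInd t) *ᵥ x)
      = circulant (pairInd t) *ᵥ (circulant x *ᵥ (circulant (pairInd t) *ᵥ x)) := by
          rw [← conv_assoc (pairInd t) x (circulant (pairInd t) *ᵥ x)]
    _ = circulant (pairInd t) *ᵥ (circulant (circulant x *ᵥ pairInd t) *ᵥ x) := by
          rw [conv_assoc x (pairInd t) x]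
    _ = circulant (pairInd t) *ᵥ (circulant (circulant (pairInd t) *ᵥ x) *ᵥ x) := by
          rw [conv_comm x (pairInd t)]
    _ = circulant (pairInd t) *ᵥ (circulant (pairInd t) *ᵥ (circulant x *ᵥ x)) := by
          rw [← conv_assoc (pairInd t) x x]
    _ = circulant (circulant (pairInd t) *ᵥ pairInd t) *ᵥ (circulant x *ᵥ x) := by
          rw [conv_assoc (pairInd t) (pairInd t)]
    _ = 0 := by rw [pairInd_conv_pairInd h2, Matrix.circulant_zero, Matrix.zero_mulVec]

/-! ## The halving lemma: a `t`-periodic function is `e ⋆ x₀` -/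

/-- **Halving lemma.**  If `t ≠ 0`, `t + t = 0` and `x` is `t`-periodic (`x ⋆ e = 0`), then `x = e ⋆ x₀` for some `x₀`
(take `x₀ = x` on a transversal of the cosets `{g, g + t}` — here `{g : f g < f (g + t)}` for an enumeration `f` of `G` —
and `0` elsewhere). -/
theorem exists_conv_pairInd_eq {t : G} (ht : t ≠ 0) (h2 : t + t = 0) {x : G → ZMod 2}
    (hx : circulant x *ᵥ pairInd t = 0) : ∃ x₀ : G → ZMod 2, circulant (pairInd t) *ᵥ x₀ = x := by
  classical
  have hper := (conv_pairInd_eq_zero_iff x t).mp hx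
  have hgt : ∀ g : G, g + t ≠ g := fun g h => ht (by simpa using h)
  have hsub : ∀ g : G, g - t = g + t := fun g => by
    rw [sub_eq_add_neg, neg_eq_iff_add_eq_zero.mpr h2]
  have hgg : ∀ g : G, g + t + t = g := fun g => by rw [add_assoc, h2, add_zero]
  -- the transversal `S = {g : f g < f (g + t)}` of an enumeration `f`
  obtain ⟨f⟩ : Nonempty (G ≃ Fin (Fintype.card G)) := ⟨Fintype.equivFin G⟩
  refine ⟨fun g => if f g < f (g + t) then x g else 0, ?_⟩
  have hS : ∀ g, (f (g + t) < f (g + t + t)) ↔ ¬ (f g < f (g + t)) := by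
    intro g
    rw [hgg, not_lt]
    exact ⟨fun h => h.le, fun h => lt_of_le_of_ne h (fun heq => hgt g (f.injective heq))⟩
  rw [conv_comm]
  funext g
  rw [conv_pairInd_apply, hsub]
  by_cases hg : f g < f (g + t)
  · have h1 : ¬ (f (g + t) < f (g + t + t)) := fun h => ((hS g).mp h) hg
    simp only [hg, if_true, h1, if_false, add_zero]
  · have h1 : f (g + t) < f (g + t + t) := (hS g).mpr hg
    simp only [hg, if_false, h1, if_true, zero_add]
    rw [hper (g + t), add_sub_cancel_right]

/-! ## Non-triviality of `(e, 0)` -/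

/-- **Key algebraic step.**  `t ≠ 0`, `2t = 0`, `b` periodic (`b ⋆ e = 0`), `a ≠ 0`: there is NO `s` with `b ⋆ s = e` and
`a ⋆ s = 0` (see the module docstring for the five-line computation: `e ⋆ (b₀ ⋆ s) = e` makes `c = b₀ ⋆ s + δ₀` periodic,
so `c ⋆ c = 0`, while `a ⋆ c = a`). -/
theorem no_stabilizer_decomposition {t : G} (ht : t ≠ 0) (h2 : t + t = 0) {a b : G → ZMod 2}
    (hb : circulant b *ᵥ pairInd t = 0) (ha0 : a ≠ 0)
    (s : G → ZMod 2) (hbs : circulant b *ᵥ s = pairInd t) (has : circulant a *ᵥ s = 0) : False := by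
  -- b = e ⋆ b₀
  obtain ⟨b₀, hb₀⟩ := exists_conv_pairInd_eq ht h2 hb
  -- u := b₀ ⋆ s satisfies e ⋆ u = e
  have heu : circulant (pairInd t) *ᵥ (circulant b₀ *ᵥ s) = pairInd t := by
    rw [conv_assoc, hb₀, hbs]
  -- c := u + δ₀ is periodic, hence c = e ⋆ c₀ and c ⋆ c = 0
  have hce : circulant (circulant b₀ *ᵥ s + Pi.single 0 1) *ᵥ pairInd t = 0 := by
    rw [conv_comm, Matrix.mulVec_add, heu, conv_single_zero, add_self_fun]
  obtain ⟨c₀, hc₀⟩ := exists_conv_pairInd_eq ht h2 hce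
  have hcc : circulant (circulant b₀ *ᵥ s + Pi.single 0 1) *ᵥ (circulant b₀ *ᵥ s + Pi.single 0 1) = 0 := by
    rw [← hc₀]; exact conv_self_of_pairInd_conv h2 c₀
  -- a ⋆ u = b₀ ⋆ (a ⋆ s) = 0
  have hau : circulant a *ᵥ (circulant b₀ *ᵥ s) = 0 := by
    rw [conv_assoc, conv_comm a b₀, ← conv_assoc, has, Matrix.mulVec_zero]
  -- a ⋆ c = a
  have hac : circulant a *ᵥ (circulant b₀ *ᵥ s + Pi.single 0 1) = a := by
    rw [Matrix.mulVec_add, conv_single_zero, hau, zero_add]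
  -- a = a ⋆ c ⋆ c = 0
  have h1 : a = circulant (circulant a *ᵥ (circulant b₀ *ᵥ s + Pi.single 0 1)) *ᵥ
      (circulant b₀ *ᵥ s + Pi.single 0 1) := by
    conv_lhs => rw [← hac, ← hac]
  rw [← conv_assoc, hcc, Matrix.mulVec_zero] at h1
  exact ha0 h1

/-- **`(e, 0)` is a non-trivial `Z`-vector** (not in the row space of `H_Z = [Bᵀ|Aᵀ]`) when `a ≠ 0` and `b` is periodic. -/
theorem sumElim_pairInd_not_mem_rowSpace {t : G} (ht : t ≠ 0) (h2 : t + t = 0) {a b : G → ZMod 2}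
    (hb : circulant b *ᵥ pairInd t = 0) (ha0 : a ≠ 0) :
    Sum.elim (pairInd t) (0 : G → ZMod 2) ∉ LinearMap.range (HZ a b).vecMulLinear := by
  intro hmem
  obtain ⟨s, hbs, has⟩ := (sumElim_mem_range_vecMulLinear_HZ_iff a b (pairInd t) 0).mp hmem
  exact no_stabilizer_decomposition ht h2 hb ha0 s hbs has

/-- Symmetrically **`(0, e)` is a non-trivial `Z`-vector** when `b ≠ 0` and `a` is periodic. -/
theorem sumElim_zero_pairInd_not_mem_rowSpace {t : G} (ht : t ≠ 0) (h2 : t + t = 0) {a b : G → ZMod 2}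
    (ha : circulant a *ᵥ pairInd t = 0) (hb0 : b ≠ 0) :
    Sum.elim (0 : G → ZMod 2) (pairInd t) ∉ LinearMap.range (HZ a b).vecMulLinear := by
  intro hmem
  obtain ⟨s, hbs, has⟩ := (sumElim_mem_range_vecMulLinear_HZ_iff a b 0 (pairInd t)).mp hmem
  exact no_stabilizer_decomposition ht h2 ha hb0 s has hbs

/-- For `a = b = 0` nothing is a stabilizer: `(e, 0) ∉ rs H_Z` (`e ≠ 0`). -/
theorem sumElim_pairInd_not_mem_rowSpace_zero {t : G} (ht : t ≠ 0) :
    Sum.elim (pairInd t) (0 : G → ZMod 2) ∉ LinearMap.range (HZ (0 : G → ZMod 2) 0).vecMulLinear := by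
  intro hmem
  obtain ⟨s, hbs, -⟩ := (sumElim_mem_range_vecMulLinear_HZ_iff 0 0 (pairInd t) 0).mp hmem
  rw [Matrix.circulant_zero, Matrix.zero_mulVec] at hbs
  have h := congr_fun hbs 0
  simp [pairInd, ht.symm] at h

/-! ## The distance bound -/

/-- `|δ₀ + δ_t| = 2` for `t ≠ 0`. -/
theorem hammingNorm_pairInd {t : G} (ht : t ≠ 0) : hammingNorm (pairInd t : G → ZMod 2) = 2 := by
  unfold hammingNorm
  have hset : (Finset.univ.filter fun g : G => pairInd t g ≠ 0) = ({0, t} : Finset G) := by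
    ext g
    simp only [pairInd, Finset.mem_filter, Finset.mem_univ, true_and, Finset.mem_insert, Finset.mem_singleton,
      Pi.add_apply, Pi.single_apply]
    by_cases h0 : g = 0
    · subst h0; simp [ht.symm]
    · by_cases h1 : g = t
      · subst h1; simp [h0]
      · simp [h0, h1]
  rw [hset, Finset.card_pair ht.symm]

omit [DecidableEq G] in
/-- `|(u, v)| = |u| + |v|`. [folklore] -/
theorem hammingNorm_sumElim (u v : G → ZMod 2) : hammingNorm (Sum.elim u v) = hammingNorm u + hammingNorm v := by
  unfold hammingNorm
  rw [← Finset.card_disjSum]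
  congr 1
  ext i
  rcases i with i | i <;> simp [Finset.mem_disjSum]

/-- **`d_Z ≤ 2` when an order-2 pair indicator lies in `ker A ∩ ker B`.**  For every finite abelian `G`, `a, b ∈ 𝔽₂[G]`
and `t ∈ G` with `t ≠ 0`, `t + t = 0`: if `A (δ₀ + δ_t) = 0` and `B (δ₀ + δ_t) = 0` then `d_Z(css a b) ≤ 2`
(`= |δ₀ + δ_t|`, `hammingNorm_pairInd`).  The kernel-weight bound of X-2 thus HOLDS for kernel elements that are
indicators of order-2 subgroups (and their translates, by translation invariance of the code). -/
theorem css_dZ_le_two_of_pair_mem_ker {t : G} (ht : t ≠ 0) (h2 : t + t = 0) {a b : G → ZMod 2}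
    (ha : circulant a *ᵥ pairInd t = 0) (hb : circulant b *ᵥ pairInd t = 0) : (css a b).dZ ≤ 2 := by
  rw [← hammingNorm_pairInd ht]
  by_cases ha0 : a ≠ 0
  · -- `(e, 0)` is a weight-2 non-trivial Z-logical
    have hker : (css a b).HX *ᵥ Sum.elim (pairInd t) (0 : G → ZMod 2) = 0 := by
      rw [css_HX, HX_mulVec_sumElim, Matrix.mulVec_zero, add_zero, ha]
    have hw : hammingNorm (Sum.elim (pairInd t) (0 : G → ZMod 2)) = hammingNorm (pairInd t) := by
      rw [hammingNorm_sumElim, hammingNorm_zero, add_zero]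
    rw [← hw]
    exact (css a b).dZ_le_hammingNorm hker (sumElim_pairInd_not_mem_rowSpace ht h2 hb ha0)
  · rw [not_ne_iff] at ha0
    by_cases hb0 : b ≠ 0
    · -- `(0, e)`
      have hker : (css a b).HX *ᵥ Sum.elim (0 : G → ZMod 2) (pairInd t) = 0 := by
        rw [css_HX, HX_mulVec_sumElim, Matrix.mulVec_zero, zero_add, hb]
      have hw : hammingNorm (Sum.elim (0 : G → ZMod 2) (pairInd t)) = hammingNorm (pairInd t) := by
        rw [hammingNorm_sumElim, hammingNorm_zero, zero_add]
      rw [← hw]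
      exact (css a b).dZ_le_hammingNorm hker (sumElim_zero_pairInd_not_mem_rowSpace ht h2 ha hb0)
    · rw [not_ne_iff] at hb0
      subst ha0; subst hb0
      have hker : (css (0 : G → ZMod 2) 0).HX *ᵥ Sum.elim (pairInd t) (0 : G → ZMod 2) = 0 := by
        rw [css_HX, HX_mulVec_sumElim, Matrix.mulVec_zero, add_zero, Matrix.circulant_zero, Matrix.zero_mulVec]
      have hw : hammingNorm (Sum.elim (pairInd t) (0 : G → ZMod 2)) = hammingNorm (pairInd t) := by
        rw [hammingNorm_sumElim, hammingNorm_zero, add_zero]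
      rw [← hw]
      exact (css (0 : G → ZMod 2) 0).dZ_le_hammingNorm hker (sumElim_pairInd_not_mem_rowSpace_zero ht)

/-- **`d_X ≤ 2`** likewise (`d_X = d_Z` for abelian two-block codes, `css_dX_eq_dZ`). -/
theorem css_dX_le_two_of_pair_mem_ker {t : G} (ht : t ≠ 0) (h2 : t + t = 0) {a b : G → ZMod 2}
    (ha : circulant a *ᵥ pairInd t = 0) (hb : circulant b *ᵥ pairInd t = 0) : (css a b).dX ≤ 2 := by
  rw [css_dX_eq_dZ]
  exact css_dZ_le_two_of_pair_mem_ker ht h2 ha hb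

/-- X-2's shape: **`d_Z ≤ |e|` for the kernel element `e = δ₀ + δ_t`** (`t` of order 2, `A e = B e = 0`). -/
theorem css_dZ_le_hammingNorm_pairInd {t : G} (ht : t ≠ 0) (h2 : t + t = 0) {a b : G → ZMod 2}
    (ha : circulant a *ᵥ pairInd t = 0) (hb : circulant b *ᵥ pairInd t = 0) :
    (css a b).dZ ≤ hammingNorm (pairInd t) := by
  rw [hammingNorm_pairInd ht]
  exact css_dZ_le_two_of_pair_mem_ker ht h2 ha hb

end Summit.Ventures.QEC.TwoBlockOrderTwo
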